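import Literature.Barriers.NavierStokesRegularity.CriticalBesovNormInflation
import Literature.Analysis.FluidPDE.BourgainPavlovicContinuation
import Literature.Analysis.FluidPDE.BourgainPavlovicSignal
import Literature.Analysis.FluidPDE.LittlewoodPaleyFields
import Literature.Analysis.FluidPDE.CriticalSpacesProofs
import Literature.Analysis.FunctionSpaces.SobolevDomainProofs
import Mathlib.Analysis.Fourier.Inversion
import HarnessLib

/-!
# Discharge of the barrier `CriticalBesovNormInflation` (Bourgain–Pavlović 2008, Thm. 1.1)

This file proves `CriticalBesovNormInflation_holds : CriticalBesovNormInflation`: for every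
`δ > 0` there are a Schwartz, divergence-free datum `u₀` on `ℝ³` with
`‖u₀‖_{Ḃ^{-1}_{∞,∞}} ≤ δ`, a time `0 < t < δ` and a bounded classical solution of Navier–Stokes
(`ν = 1`) from `u₀` on `[0, t] × ℝ³` whose `Ḃ^{-1}_{∞,∞}` norm at time `t` exceeds `1/δ`. The
construction is Bourgain–Pavlović's (J. Funct. Anal. 255 (2008), §3), carried out entirely on the
Fourier side of the tree's proved Fourier–Picard theory in the series of support files
`BourgainPavlovicData` … `BourgainPavlovicContinuation` (`Literature/Analysis/FluidPDE/`):

* the datum `a₀` (`InflationParams.datum`): `r` lacunary pairs of bumps `ψ(· ∓ k_s)`,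
  `ψ(· ∓ k'_s)` with `k_s − k'_s = η = e₀`, amplitude `α = Q/√r`, polarised so that the Euler
  interaction of each pair feeds the low mode `η` (BP (3.1)–(3.3)); `u₀ = synthVel a₀` is a
  Schwartz divergence-free field with `‖u₀‖_{Ḃ^{-1}_{∞,∞}} ≤ 96 α m`
  (`BourgainPavlovicSchwartz`);
* the solution exists on `[0, T]` and `u = e^{tΔ}u₀ − u₁ + y` with the remainder controlled in the
  band Lei–Lin path norm, `pathNorm T y ≤ 2ε(T)` (`BourgainPavlovicRemainder`,
  `BourgainPavlovicContinuation`; BP (3.13)–(3.39));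
* the second iterate at the low mode is `2πi ×` a sign-definite real quantity
  `≥ α² r (ψ⋆ψ)(ξ−η)/250` (`BourgainPavlovicSignal`; BP (3.6)–(3.8), (3.22)–(3.24)).

Here these are assembled: the Littlewood–Paley block `Δ̇₀ u(T)` is computed on the Fourier side
(`blockFn_zero_synthVel_apply`: `Δ̇₀ (Re 𝓕 W) = Re 𝓕 (φ₀ W)` for an integrable continuous
coefficient field, by Fubini and Fourier inversion of the Littlewood–Paley kernel), evaluated at
`x₀ = e₀/4`, where the resonant part contributes `≥ 4π · ½ · cos(πρ) · α² r m²/250` and the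
remainder at most `2 · pathNormInf ≤ 4 ε(T)`; the parameters are then chosen in the order
`ρ` (continuity of `φ₀` at `±e₀`, where `φ₀ = 1`), `Q² = α² r` (size `1/δ`), `T` (`< δ`, small),
`r` (large, so that `α → 0` closes the bootstrap), `n₀` (`8π² N_0² T ≥ 1`).

## References

* J. Bourgain, N. Pavlović, *Ill-posedness of the Navier–Stokes equations in a critical space in
  3D*, J. Funct. Anal. 255 (2008), 2233–2247, Thm. 1.1 and §3. [BourgainPavlovic2008]
* H. Bahouri, J.-Y. Chemin, R. Danchin, *Fourier Analysis and Nonlinear PDE*, Springer 2011,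
  Prop. 2.10, Def. 2.15. [BahouriCheminDanchin2011]
-/

noncomputable section

open MeasureTheory Real Set Filter Topology Function Complex FourierTransform
open scoped ENNReal NNReal ComplexConjugate FourierTransform RealInnerProductSpace SchwartzMap

namespace Literature.Barriers.NavierStokesRegularity

open Literature.Analysis.FluidPDE Literature.Analysis.FluidPDE.FourierNS
  Literature.Analysis.FunctionSpaces Literature.Analysis.FluidPDE.BourgainPavlovic

/-- Local notation for physical / frequency space `ℝ³`. -/
local notation "E3" => EuclideanSpace ℝ (Fin 3)

/-! ### The Littlewood–Paley symbol `φ₀` as a function -/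

/-- `φ₀` is continuous. [folklore] -/
theorem continuous_dyadicSymbol_zero : Continuous (dyadicSymbol (E := E3) 0) := by
  rw [← coe_dyadicSymbolSchwartz]; exact (dyadicSymbolSchwartz E3 0).continuous

/-- `φ₀` is integrable. [folklore] -/
theorem integrable_dyadicSymbol_zero : Integrable (dyadicSymbol (E := E3) 0) := by
  rw [← coe_dyadicSymbolSchwartz]; exact (dyadicSymbolSchwartz E3 0).integrable

/-- `𝓕 φ₀` is integrable. [folklore] -/
theorem integrable_fourier_dyadicSymbol_zero : Integrable (𝓕 (dyadicSymbol (E := E3) 0)) := by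
  rw [← coe_dyadicSymbolSchwartz, ← SchwartzMap.fourier_coe]; exact (𝓕 (dyadicSymbolSchwartz E3 0)).integrable

/-- `|φ₀(ξ)| ≤ 1` (`φ₀ = χ(ξ) − χ(2ξ)` with `0 ≤ χ ≤ 1`). [cite: BahouriCheminDanchin2011, Prop. 2.10] -/
theorem norm_dyadicSymbol_zero_le_one (ξ : E3) : ‖dyadicSymbol (E := E3) 0 ξ‖ ≤ 1 := by
  rw [dyadicSymbol, Complex.norm_real, Real.norm_eq_abs, abs_le]
  have h1 := (dyadicCutoff E3).nonneg (x := ((2 : ℝ) ^ (-(0 : ℤ))) • ξ)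
  have h2 := (dyadicCutoff E3).le_one (x := ((2 : ℝ) ^ (-(0 : ℤ))) • ξ)
  have h3 := (dyadicCutoff E3).nonneg (x := ((2 : ℝ) ^ (1 - (0 : ℤ))) • ξ)
  have h4 := (dyadicCutoff E3).le_one (x := ((2 : ℝ) ^ (1 - (0 : ℤ))) • ξ)
  constructor <;> linarith

/-- `φ₀(ξ) = 1` on the unit sphere (`χ(ξ) = 1`, `χ(2ξ) = 0`). [cite: BahouriCheminDanchin2011, Prop. 2.10] -/
theorem dyadicSymbol_zero_of_norm_eq_one {ξ : E3} (h : ‖ξ‖ = 1) : dyadicSymbol (E := E3) 0 ξ = 1 := by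
  rw [dyadicSymbol]
  have e1 : ((2 : ℝ) ^ (-(0 : ℤ))) • ξ = ξ := by simp
  have e2 : ((2 : ℝ) ^ (1 - (0 : ℤ))) • ξ = (2 : ℝ) • ξ := by simp
  rw [e1, e2, dyadicCutoff_apply_of_norm_le_one (le_of_eq h),
    dyadicCutoff_apply_of_two_le_norm (by rw [norm_smul, h]; norm_num)]
  norm_num

/-- Where `φ₀ ≠ 0`, `1/2 < ‖ξ‖ < 2`. [cite: BahouriCheminDanchin2011, Prop. 2.10] -/
theorem shell_of_dyadicSymbol_zero_ne_zero {ξ : E3} (h : dyadicSymbol (E := E3) 0 ξ ≠ 0) :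
    1 / 2 < ‖ξ‖ ∧ ‖ξ‖ < 2 := by
  have := InflationParams.shell_of_dyadicSymbol_ne_zero (j := 0) h
  norm_num at this
  exact this

/-- **Fourier inversion of the Littlewood–Paley kernel**: `𝓕⁻ K₀ = φ₀`
(`K₀ = 𝓕⁻ φ₀` real and even). [folklore] -/
theorem fourierInv_blockKernel_zero (ξ : E3) :
    𝓕⁻ (fun t : E3 => (blockKernel E3 0 t : ℂ)) ξ = dyadicSymbol (E := E3) 0 ξ := by
  have hK : (fun t : E3 => (blockKernel E3 0 t : ℂ)) = 𝓕⁻ (dyadicSymbol (E := E3) 0) := by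
    funext t
    rw [ofReal_blockKernel, blockKernelC_apply]
  rw [hK, Real.fourierInv_eq_fourier_neg,
    continuous_dyadicSymbol_zero.fourier_fourierInv_eq integrable_dyadicSymbol_zero
      integrable_fourier_dyadicSymbol_zero, dyadicSymbol_neg]

/-! ### The block `Δ̇₀` of a synthesized field on the Fourier side -/

/-- **`Δ̇₀ (Re 𝓕 W) = Re 𝓕 (φ₀ W)`, componentwise**, for a continuous integrable coefficient field
`W : ℝ³ → ℂ³` (Fubini and `𝓕⁻ K₀ = φ₀`). [cite: BahouriCheminDanchin2011, (2.5)] -/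
theorem blockFn_zero_synthVel_apply {W : E3 → Fin 3 → ℂ} (hWc : Continuous W) (hWi : Integrable W)
    {M : ℝ} (hM : ∀ x, ‖synthVel W x‖ ≤ M) (x : E3) (l : Fin 3) :
    blockFn 0 (synthVel W) x l = (𝓕 (fun ξ => dyadicSymbol (E := E3) 0 ξ * W ξ l) x).re := by
  haveI : Fact ((1 : ℝ≥0∞) ≤ ∞) := ⟨le_top⟩
  have hWl : Integrable fun ξ => W ξ l := by
    refine hWi.norm.mono' ((continuous_apply l).comp hWc).aestronglyMeasurable
      (Eventually.of_forall fun ξ => norm_le_pi_norm (W ξ) l)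
  -- the synthesized field is bounded and continuous, hence in `L^∞`
  have hWi' : ∀ i, Integrable fun ξ => W ξ i := fun i =>
    hWi.norm.mono' ((continuous_apply i).comp hWc).aestronglyMeasurable
      (Eventually.of_forall fun ξ => norm_le_pi_norm (W ξ) i)
  have hsc : Continuous (synthVel W) := by
    change Continuous fun x => ClayDatum.reVec fun l => 𝓕 (fun ξ => W ξ l) x
    exact ClayDatum.reVec.continuous.comp (continuous_pi fun l =>
      VectorFourier.fourierIntegral_continuous Real.continuous_fourierChar continuous_inner (hWi' l))
  have hmem : MemLp (synthVel W) ∞ volume :=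
    memLp_top_of_bound hsc.aestronglyMeasurable M (Eventually.of_forall hM)
  -- component `l` of the convolution integral
  rw [blockFn_apply]
  have hint := integrable_blockKernel_smul_sub 0 hmem x
  rw [show (∫ t, blockKernel E3 0 t • synthVel W (x - t)) l =
      ∫ t, (blockKernel E3 0 t • synthVel W (x - t)) l from
    ((EuclideanSpace.proj l).integral_comp_comm hint).symm]
  simp only [PiLp.smul_apply, synthVel_apply, smul_eq_mul]
  -- `K₀ t · Re(𝓕 W_l (x - t)) = Re (K₀ t · 𝓕 W_l (x - t))`
  have hre : ∀ t, blockKernel E3 0 t * (𝓕 (fun ξ => W ξ l) (x - t)).re =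
      ((blockKernel E3 0 t : ℂ) * 𝓕 (fun ξ => W ξ l) (x - t)).re := fun t => by
    simp [Complex.mul_re]
  simp_rw [hre]
  -- integrability of `t ↦ K₀ t · 𝓕 W_l (x - t)`
  have hFb : ∀ y, ‖𝓕 (fun ξ => W ξ l) y‖ ≤ ∫ ξ, ‖W ξ l‖ := fun y =>
    VectorFourier.norm_fourierIntegral_le_integral_norm _ _ _ _ _
  have hFc : Continuous (𝓕 (fun ξ => W ξ l)) :=
    VectorFourier.fourierIntegral_continuous Real.continuous_fourierChar continuous_inner hWl
  have hprod : Integrable fun t => (blockKernel E3 0 t : ℂ) * 𝓕 (fun ξ => W ξ l) (x - t) := by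
    refine (((integrable_blockKernel (E := E3) 0).ofReal (𝕜 := ℂ)).norm.mul_const (∫ ξ, ‖W ξ l‖)).mono'
      ((Complex.continuous_ofReal.comp (continuous_blockKernel 0)).mul
        (hFc.comp (continuous_const.sub continuous_id))).aestronglyMeasurable
      (Eventually.of_forall fun t => ?_)
    rw [norm_mul]
    exact mul_le_mul_of_nonneg_left (hFb _) (norm_nonneg _)
  have hre' := integral_re hprod
  simp only [RCLike.re_to_complex] at hre'
  rw [hre']
  congr 1
  -- Fubini: `∫_t K₀(t) ∫_ξ 𝐞(-⟨ξ, x - t⟩) W_l(ξ) = ∫_ξ W_l(ξ) 𝐞(-⟨ξ,x⟩) ∫_t K₀(t) 𝐞(⟨ξ, t⟩)`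
  set F : E3 → E3 → ℂ := fun t ξ => (blockKernel E3 0 t : ℂ) * ((𝐞 (-⟪ξ, x - t⟫) : ℂ) * W ξ l) with hF
  have hFint : Integrable (uncurry F) (volume.prod volume) := by
    have hm : Continuous (uncurry F) := by
      simp only [hF]
      refine (Complex.continuous_ofReal.comp ((continuous_blockKernel 0).comp continuous_fst)).mul
        ((Continuous.mul ?_ ((continuous_apply l).comp (hWc.comp continuous_snd))))
      exact (continuous_subtype_val.comp (Real.continuous_fourierChar.comp
        ((continuous_snd.inner (continuous_const.sub continuous_fst)).neg)))
    refine Integrable.mono' ((integrable_blockKernel (E := E3) 0).norm.mul_prod hWl.norm)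
      hm.aestronglyMeasurable (Eventually.of_forall fun p => ?_)
    simp only [hF, uncurry, norm_mul, Complex.norm_real, Circle.norm_coe, one_mul]
    exact le_of_eq rfl
  have hinner : ∀ t, 𝓕 (fun ξ => W ξ l) (x - t) = ∫ ξ, (𝐞 (-⟪ξ, x - t⟫) : ℂ) * W ξ l := fun t => by
    rw [Real.fourier_eq]; rfl
  calc ∫ t, (blockKernel E3 0 t : ℂ) * 𝓕 (fun ξ => W ξ l) (x - t)
      = ∫ t, ∫ ξ, F t ξ := by
        refine integral_congr_ae (Eventually.of_forall fun t => ?_)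
        simp only [hF, hinner t, ← MeasureTheory.integral_const_mul]
    _ = ∫ ξ, ∫ t, F t ξ := integral_integral_swap hFint
    _ = ∫ ξ, (𝐞 (-⟪ξ, x⟫) : ℂ) * (dyadicSymbol (E := E3) 0 ξ * W ξ l) := by
        refine integral_congr_ae (Eventually.of_forall fun ξ => ?_)
        simp only [hF]
        have hsplit : ∀ t : E3, (𝐞 (-⟪ξ, x - t⟫) : ℂ) = (𝐞 (-⟪ξ, x⟫) : ℂ) * (𝐞 (⟪t, ξ⟫) : ℂ) := by
          intro t
          rw [inner_sub_right, real_inner_comm t ξ, show -(⟪ξ, x⟫ - ⟪t, ξ⟫) = -⟪ξ, x⟫ + ⟪t, ξ⟫ by ring,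
            AddChar.map_add_eq_mul, Circle.coe_mul]
        simp_rw [hsplit]
        have : ∀ t : E3, (blockKernel E3 0 t : ℂ) * ((𝐞 (-⟪ξ, x⟫) : ℂ) * (𝐞 (⟪t, ξ⟫) : ℂ) * W ξ l) =
            ((𝐞 (-⟪ξ, x⟫) : ℂ) * W ξ l) * ((𝐞 (⟪t, ξ⟫)) • (blockKernel E3 0 t : ℂ)) := by
          intro t; rw [Circle.smul_def, smul_eq_mul]; ring
        simp_rw [this]
        rw [MeasureTheory.integral_const_mul, ← Real.fourierInv_eq, fourierInv_blockKernel_zero]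
        ring
    _ = 𝓕 (fun ξ => dyadicSymbol (E := E3) 0 ξ * W ξ l) x := by
        rw [Real.fourier_eq]; rfl

/-! ### Conjugation symmetry of the second iterate -/

section ConjSymm

variable (d : InflationParams)

/-- The clamped free evolution is conjugation symmetric: `Uᶜ(t, -ξ) = conj Uᶜ(t, ξ)`. [folklore] -/
theorem freeC_conj_symm (t : ℝ) (ξ : E3) (l : Fin 3) : d.freeC t (-ξ) l = conj (d.freeC t ξ l) := by
  rw [InflationParams.freeC, InflationParams.free_apply, InflationParams.free_apply, Pi.smul_apply,
    Pi.smul_apply, heat_neg, d.datum_conj_symm, Complex.real_smul, Complex.real_smul, map_mul,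
    Complex.conj_ofReal]

/-- **The second iterate is conjugation symmetric**: `u₁(t, -ξ)_l = conj u₁(t, ξ)_l`. [folklore] -/
theorem secondIterate_conj_symm (t : ℝ) (ξ : E3) (l : Fin 3) :
    d.secondIterate t (-ξ) l = conj (d.secondIterate t ξ l) := by
  have h4 := card_fin_three_lt_four
  have hU := fun s => d.hasDecay_freeC s 4
  have hint : ∀ ζ : E3, IntervalIntegrable (fun r => heat (4 * π ^ 2) ζ (t - r) •
      nonlin (d.freeC r) (d.freeC r) ζ) volume 0 t := fun ζ =>
    (continuous_heat_smul_nonlin h4 (4 * π ^ 2) d.continuous_freeC d.continuous_freeC hU hU t ζ).intervalIntegrable _ _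
  have hcomp : ∀ ζ : E3, d.secondIterate t ζ l =
      ∫ r in (0 : ℝ)..t, heat (4 * π ^ 2) ζ (t - r) * nonlin (d.freeC r) (d.freeC r) ζ l := by
    intro ζ
    rw [InflationParams.secondIterate, duhamelBilin_apply]
    have hproj := ((ContinuousLinearMap.proj (R := ℂ) (φ := fun _ : Fin 3 => ℂ) l).intervalIntegral_comp_comm
      (hint ζ)).symm
    simp only [ContinuousLinearMap.proj_apply] at hproj
    rw [hproj]
    refine intervalIntegral.integral_congr fun r _ => ?_
    simp only [Pi.smul_apply, Complex.real_smul]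
  rw [hcomp, hcomp, ← intervalIntegral.intervalIntegral_conj]
  refine intervalIntegral.integral_congr fun r _ => ?_
  rw [map_mul, Complex.conj_ofReal, heat_neg, nonlin_conj_symm (fun ξ j => freeC_conj_symm d r ξ j)
    (fun ξ j => freeC_conj_symm d r ξ j)]

end ConjSymm

/-! ### The lower bound at the low mode -/

/-- `𝐞(-⟪ξ, x₀⟫) = cos b − i sin b` with `b = 2π⟪ξ, x₀⟫`. [folklore] -/
theorem fourierChar_neg_inner (ξ x₀ : E3) :
    ((𝐞 (-⟪ξ, x₀⟫) : ℂ)) = (Real.cos (2 * π * ⟪ξ, x₀⟫) : ℂ) - Complex.I * (Real.sin (2 * π * ⟪ξ, x₀⟫) : ℂ) := by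
  rw [Real.fourierChar_apply, show ((2 * π * -⟪ξ, x₀⟫ : ℝ) : ℂ) * Complex.I = -(2 * π * ⟪ξ, x₀⟫ : ℝ) * Complex.I by
    push_cast; ring, Complex.exp_mul_I]
  simp only [Complex.cos_neg, Complex.sin_neg, Complex.ofReal_cos, Complex.ofReal_sin]
  push_cast
  ring

/-- The phase at `x₀ = η/4`: for `‖ξ − η‖ < 2ρ ≤ 1/50`, `sin(2π⟪ξ, η/4⟫) ≥ 1 − (πρ)²/2 ≥ 999/1000`. [folklore] -/
theorem sin_phase_ge {ρ : ℝ} (hρ : ρ ≤ 1 / 100) (hρ0 : 0 ≤ ρ) {ξ : E3} (hξ : ‖ξ - η‖ < 2 * ρ) :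
    (0.999 : ℝ) ≤ Real.sin (2 * π * ⟪ξ, (1 / 4 : ℝ) • (η : E3)⟫) := by
  have hcoord : |(ξ - η) 0| ≤ ‖ξ - η‖ := abs_apply_le_norm _ 0
  simp only [PiLp.sub_apply, η_apply, Fin.isValue, ↓reduceIte] at hcoord
  have hinner : ⟪ξ, (1 / 4 : ℝ) • (η : E3)⟫ = ξ 0 / 4 := by
    rw [real_inner_smul_right, EuclideanSpace.inner_eq_star_dotProduct]
    simp [dotProduct, η_apply]
    ring
  rw [hinner, show 2 * π * (ξ 0 / 4) = π / 2 - π * ((1 - ξ 0) / 2) by ring, Real.sin_pi_div_two_sub]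
  have hdev : |1 - ξ 0| ≤ 2 * ρ := by
    rw [abs_sub_comm]; exact hcoord.trans hξ.le
  have hsmall : |π * ((1 - ξ 0) / 2)| ≤ π * ρ := by
    rw [abs_mul, abs_of_pos Real.pi_pos, abs_div, abs_two]
    refine mul_le_mul_of_nonneg_left ?_ Real.pi_pos.le
    linarith
  have hc := Real.one_sub_sq_div_two_le_cos (x := π * ((1 - ξ 0) / 2))
  have hsq : (π * ((1 - ξ 0) / 2)) ^ 2 ≤ (π * ρ) ^ 2 := by
    rw [← sq_abs (π * ((1 - ξ 0) / 2))]
    exact pow_le_pow_left₀ (abs_nonneg _) hsmall 2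
  have hπ := Real.pi_lt_d2
  have hπρ : π * ρ ≤ 3.15 * (1 / 100) := mul_le_mul hπ.le hρ hρ0 (by norm_num)
  have hπρ0 : 0 ≤ π * ρ := by positivity
  have h3 : (π * ρ) ^ 2 ≤ (3.15 * (1 / 100)) ^ 2 := pow_le_pow_left₀ hπρ0 hπρ 2
  nlinarith

/-- **The lower bound for the block at the low mode.** For the controlled solution `V` on `[0, T]`
and `x₀ = η/4`:
`0.025 α² r m² − 4 ε(T) ≤ Re 𝓕(φ₀ V(T)₂)(x₀)` (the resonant part of `u₁` through
`signal_lower_bound`, doubled by conjugation symmetry, against the remainder bounded by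
`2 · xNeg(y(T)) ≤ 4ε`; the free part vanishes on the support of `φ₀`). [cite: BourgainPavlovic2008, (3.22)–(3.25), (3.39)–(3.40)] -/
theorem block_lower_bound (d : InflationParams) (hρ : d.ρ ≤ 1 / 100) {T : ℝ} (hT0 : 0 < T) (hT : T ≤ 1 / 400)
    (hNT : 1 ≤ 8 * π ^ 2 * d.N 0 ^ 2 * T) {ρ₀ : ℝ} (hρρ₀ : 2 * d.ρ ≤ ρ₀)
    (hφ : ∀ ξ : E3, ‖ξ - η‖ < ρ₀ → 1 / 2 ≤ (dyadicSymbol (E := E3) 0 ξ).re)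
    {V : ℝ → E3 → Fin 3 → ℂ} (hV : IsFourierMild (4 * π ^ 2) 4 0 T V)
    (hZ : pathNorm T (d.remainder V) ≤ 2 * d.forcing T) (hε : d.forcing T < ⊤) :
    0.025 * d.α ^ 2 * d.r * d.bumpMass ^ 2 - 4 * (d.forcing T).toReal ≤
      (𝓕 (fun ξ : E3 => dyadicSymbol (E := E3) 0 ξ * V T ξ 2) ((1 / 4 : ℝ) • (η : E3))).re := by
  set x₀ : E3 := (1 / 4 : ℝ) • (η : E3) with hx₀
  set y := d.remainder V with hy
  set φ₀ : E3 → ℂ := dyadicSymbol (E := E3) 0 with hφ₀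
  have hρ0 := d.ρ_pos.le
  have hα := d.α_pos.le
  have hm := d.bumpMass_nonneg
  -- regularity
  obtain ⟨Ay, hAy⟩ := d.hasDecay_remainder (K := 4) (hV.decay 4)
  obtain ⟨Au, hAu⟩ := d.hasDecay_secondIterate_uniform 4
  have hyc : Continuous (y T) := (d.continuous_remainder hV.cont).uncurry_left T
  have huc : Continuous (d.secondIterate T) := d.continuous_secondIterate.uncurry_left T
  have hyi : Integrable (y T) :=
    (hAy T).integrable InflationParams.finrank_lt_four hyc.aestronglyMeasurable
  have hui : Integrable (d.secondIterate T) :=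
    (hAu T hT0.le).integrable InflationParams.finrank_lt_four huc.aestronglyMeasurable
  have hφc : Continuous φ₀ := continuous_dyadicSymbol_zero
  have hφb : ∀ ξ, ‖φ₀ ξ‖ ≤ 1 := norm_dyadicSymbol_zero_le_one
  -- the decomposition of `V T` on the support of `φ₀`
  have hdecomp : ∀ ξ : E3, φ₀ ξ * V T ξ 2 = φ₀ ξ * y T ξ 2 - φ₀ ξ * d.secondIterate T ξ 2 := by
    intro ξ
    by_cases hz : φ₀ ξ = 0
    · simp [hz]
    · have hsh := shell_of_dyadicSymbol_zero_ne_zero hz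
      have hfree : d.freeC T ξ = 0 := d.freeC_eq_zero_of_norm_le_six T (by linarith [hsh.2])
      have : V T ξ 2 = y T ξ 2 - d.secondIterate T ξ 2 := by
        have e : y T ξ = V T ξ - d.freeC T ξ + d.u1C T ξ := rfl
        rw [d.u1C_of_nonneg hT0.le, hfree, sub_zero] at e
        rw [e]; simp
      rw [this]; ring
  -- integrability of the two pieces
  have hint_y : Integrable fun ξ : E3 => φ₀ ξ * y T ξ 2 := by
    refine (hyi.norm).mono' (hφc.mul ((continuous_apply 2).comp hyc)).aestronglyMeasurable
      (Eventually.of_forall fun ξ => ?_)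
    rw [norm_mul]
    calc ‖φ₀ ξ‖ * ‖y T ξ 2‖ ≤ 1 * ‖y T ξ‖ := mul_le_mul (hφb ξ) (norm_le_pi_norm _ 2) (norm_nonneg _) zero_le_one
      _ = ‖y T ξ‖ := one_mul _
  have hint_u : Integrable fun ξ : E3 => φ₀ ξ * d.secondIterate T ξ 2 := by
    refine (hui.norm).mono' (hφc.mul ((continuous_apply 2).comp huc)).aestronglyMeasurable
      (Eventually.of_forall fun ξ => ?_)
    rw [norm_mul]
    calc ‖φ₀ ξ‖ * ‖d.secondIterate T ξ 2‖ ≤ 1 * ‖d.secondIterate T ξ‖ :=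
          mul_le_mul (hφb ξ) (norm_le_pi_norm _ 2) (norm_nonneg _) zero_le_one
      _ = ‖d.secondIterate T ξ‖ := one_mul _
  -- the Fourier integral splits
  have hsplit : 𝓕 (fun ξ : E3 => φ₀ ξ * V T ξ 2) x₀ =
      𝓕 (fun ξ : E3 => φ₀ ξ * y T ξ 2) x₀ - 𝓕 (fun ξ : E3 => φ₀ ξ * d.secondIterate T ξ 2) x₀ := by
    rw [show (fun ξ : E3 => φ₀ ξ * V T ξ 2) = (fun ξ => φ₀ ξ * y T ξ 2) - fun ξ => φ₀ ξ * d.secondIterate T ξ 2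
      from funext fun ξ => by simp [hdecomp ξ]]
    rw [Real.fourier_eq, Real.fourier_eq, Real.fourier_eq]
    simp only [Pi.sub_apply, smul_sub]
    exact integral_sub ((Real.fourierIntegral_convergent_iff x₀).2 hint_y)
      ((Real.fourierIntegral_convergent_iff x₀).2 hint_u)
  rw [hsplit, Complex.sub_re]
  /- (1) the remainder part: `|Re 𝓕(φ₀ y₂)(x₀)| ≤ 2 xNeg(y T) ≤ 4 ε` -/
  have hy_part : |(𝓕 (fun ξ : E3 => φ₀ ξ * y T ξ 2) x₀).re| ≤ 4 * (d.forcing T).toReal := by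
    -- the weight `2 ‖ξ‖⁻¹ ‖y T ξ‖` dominates `‖φ₀ ξ‖ ‖y T ξ 2‖`
    have hxNeg : xNeg (y T) ≤ 2 * d.forcing T :=
      (xNeg_le_pathNormInf (Φ := y) ⟨hT0.le, le_rfl⟩).trans (pathNormInf_le_pathNorm.trans hZ)
    have hxNeg_lt : xNeg (y T) < ⊤ := lt_of_le_of_lt hxNeg (ENNReal.mul_lt_top (by norm_num) hε)
    set g : E3 → ℝ := fun ξ => 2 * (‖ξ‖⁻¹ * ‖y T ξ‖) with hg
    have hgm : AEStronglyMeasurable g volume :=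
      (((continuous_norm.measurable.inv).mul hyc.norm.measurable).const_mul 2).aestronglyMeasurable
    have hg_nonneg : ∀ ξ, 0 ≤ g ξ := fun ξ => by positivity
    have hg_lint : ∫⁻ ξ, ENNReal.ofReal (g ξ) = 2 * xNeg (y T) := by
      rw [xNeg, ← lintegral_const_mul' _ _ ENNReal.ofNat_ne_top]
      refine lintegral_congr_ae ?_
      have h0 : ∀ᵐ ξ : E3 ∂volume, ξ ≠ 0 := by rw [ae_iff]; simp
      filter_upwards [h0] with ξ hξ
      rw [hg]; dsimp only
      rw [ENNReal.ofReal_mul zero_le_two, ENNReal.ofReal_ofNat, ENNReal.ofReal_mul (by positivity),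
        ENNReal.ofReal_inv_of_pos (norm_pos_iff.2 hξ), ofReal_norm, ofReal_norm, enorm_eq_nnnorm ξ]
    have hg_int : Integrable g := by
      refine ⟨hgm, ?_⟩
      rw [hasFiniteIntegral_iff_ofReal (Eventually.of_forall hg_nonneg), hg_lint]
      exact ENNReal.mul_lt_top (by norm_num) hxNeg_lt
    have hbound : ∀ ξ : E3, ‖(𝐞 (-⟪ξ, x₀⟫)) • (φ₀ ξ * y T ξ 2)‖ ≤ g ξ := by
      intro ξ
      rw [Circle.norm_smul, norm_mul]
      by_cases hz : φ₀ ξ = 0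
      · rw [hz, norm_zero, zero_mul]; exact hg_nonneg ξ
      · have hsh := shell_of_dyadicSymbol_zero_ne_zero hz
        have hn0 : 0 < ‖ξ‖ := by linarith [hsh.1]
        have h1 : (1 : ℝ) ≤ 2 * ‖ξ‖⁻¹ := by
          rw [← div_eq_mul_inv, le_div_iff₀ hn0]; linarith [hsh.2]
        calc ‖φ₀ ξ‖ * ‖y T ξ 2‖ ≤ 1 * ‖y T ξ‖ := mul_le_mul (hφb ξ) (norm_le_pi_norm _ 2) (norm_nonneg _) zero_le_one
          _ ≤ (2 * ‖ξ‖⁻¹) * ‖y T ξ‖ := mul_le_mul_of_nonneg_right h1 (norm_nonneg _)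
          _ = g ξ := by rw [hg]; ring
    calc |(𝓕 (fun ξ : E3 => φ₀ ξ * y T ξ 2) x₀).re| ≤ ‖𝓕 (fun ξ : E3 => φ₀ ξ * y T ξ 2) x₀‖ := Complex.abs_re_le_norm _
      _ ≤ ∫ ξ, g ξ := by
          rw [Real.fourier_eq]
          exact norm_integral_le_of_norm_le hg_int (Eventually.of_forall hbound)
      _ = (2 * xNeg (y T)).toReal := by
          rw [integral_eq_lintegral_of_nonneg_ae (Eventually.of_forall hg_nonneg) hgm, hg_lint]
      _ ≤ (2 * (2 * d.forcing T)).toReal :=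
          ENNReal.toReal_mono (ENNReal.mul_ne_top ENNReal.ofNat_ne_top
            (ENNReal.mul_ne_top ENNReal.ofNat_ne_top hε.ne)) (mul_le_mul' le_rfl hxNeg)
      _ = 4 * (d.forcing T).toReal := by
          rw [ENNReal.toReal_mul, ENNReal.toReal_mul]; norm_num; ring
  /- (2) the resonant part -/
  have hu_part : 0.025 * d.α ^ 2 * d.r * d.bumpMass ^ 2 ≤
      -(𝓕 (fun ξ : E3 => φ₀ ξ * d.secondIterate T ξ 2) x₀).re := by
    set h : E3 → ℂ := fun ξ => (𝐞 (-⟪ξ, x₀⟫)) • (φ₀ ξ * d.secondIterate T ξ 2) with hh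
    have hF : 𝓕 (fun ξ : E3 => φ₀ ξ * d.secondIterate T ξ 2) x₀ = ∫ ξ, h ξ := by rw [Real.fourier_eq]
    have hhi : Integrable h := (Real.fourierIntegral_convergent_iff x₀).2 hint_u
    set Bp : Set E3 := Metric.ball (η : E3) (2 * d.ρ) with hBp
    set Bm : Set E3 := Metric.ball (-(η : E3)) (2 * d.ρ) with hBm
    have hBpm : MeasurableSet Bp := measurableSet_ball
    have hBmm : MeasurableSet Bm := measurableSet_ball
    -- support of `h`
    have hsupp : ∀ ξ, ξ ∉ Bp → ξ ∉ Bm → h ξ = 0 := by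
      intro ξ hp hm'
      simp only [hh]
      by_cases hz : φ₀ ξ = 0
      · simp [hz]
      · have hsh := shell_of_dyadicSymbol_zero_ne_zero hz
        rw [hBp, Metric.mem_ball, dist_eq_norm, not_lt] at hp
        rw [hBm, Metric.mem_ball, dist_eq_norm, not_lt, sub_neg_eq_add] at hm'
        have hρ' := d.ρ_le
        have hu0 := d.secondIterate_eq_zero_of_shell T (by linarith [hsh.1]) (by linarith [hsh.2]) hp hm'
        simp [hu0]
    have hdisj : Disjoint Bp Bm := by
      rw [hBp, hBm]
      refine Metric.ball_disjoint_ball ?_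
      rw [dist_eq_norm, sub_neg_eq_add, show (η : E3) + η = (2 : ℝ) • η by rw [two_smul], norm_smul, norm_η]
      have := d.ρ_le; norm_num; linarith
    -- `∫ h = ∫_{Bp} h + ∫_{Bm} h`
    have hsum : ∫ ξ, h ξ = (∫ ξ in Bp, h ξ) + ∫ ξ in Bm, h ξ := by
      have hind : h = fun ξ => Bp.indicator h ξ + Bm.indicator h ξ := by
        funext ξ
        by_cases hp : ξ ∈ Bp
        · have hm' : ξ ∉ Bm := Set.disjoint_left.1 hdisj hp
          simp [Set.indicator_of_mem hp, Set.indicator_of_notMem hm']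
        · by_cases hm' : ξ ∈ Bm
          · simp [Set.indicator_of_notMem hp, Set.indicator_of_mem hm']
          · simp [Set.indicator_of_notMem hp, Set.indicator_of_notMem hm', hsupp ξ hp hm']
      conv_lhs => rw [hind]
      rw [integral_add (hhi.indicator hBpm) (hhi.indicator hBmm), MeasureTheory.integral_indicator hBpm, MeasureTheory.integral_indicator hBmm]
    -- the reflection `∫_{Bm} h = conj ∫_{Bp} h`
    have hconj : ∀ ξ, h (-ξ) = conj (h ξ) := by
      intro ξ
      simp only [hh, Circle.smul_def, smul_eq_mul, map_mul, hφ₀, conj_dyadicSymbol, dyadicSymbol_neg,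
        secondIterate_conj_symm d, inner_neg_left, neg_neg, ← Circle.coe_inv_eq_conj, ← AddChar.map_neg_eq_inv]
    have hrefl : ∫ ξ in Bm, h ξ = conj (∫ ξ in Bp, h ξ) := by
      rw [← integral_conj, ← MeasureTheory.integral_indicator hBmm, ← MeasureTheory.integral_indicator hBpm,
        ← integral_neg_eq_self (fun ξ => Bm.indicator h ξ) volume]
      refine integral_congr_ae (Eventually.of_forall fun ξ => ?_)
      simp only
      have hmem : (-ξ ∈ Bm) ↔ (ξ ∈ Bp) := by
        rw [hBm, hBp, Metric.mem_ball, Metric.mem_ball, dist_eq_norm, dist_eq_norm, sub_neg_eq_add,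
          show -ξ + (η : E3) = -(ξ - η) by abel, norm_neg]
      by_cases hp : ξ ∈ Bp
      · rw [Set.indicator_of_mem (hmem.2 hp), Set.indicator_of_mem hp, hconj]
      · rw [Set.indicator_of_notMem (fun hc => hp (hmem.1 hc)), Set.indicator_of_notMem hp]
    have hre2 : (∫ ξ, h ξ).re = 2 * (∫ ξ in Bp, h ξ).re := by
      rw [hsum, hrefl, Complex.add_re, Complex.conj_re]; ring
    -- on `Bp`: `Re(-h) ≥ 2π · ½ · 0.999 · 𝓡 ≥ π(0.999)(α² r/250) bumpConv(ξ - η)`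
    have hpt : ∀ ξ ∈ Bp, π * 0.999 * (d.α ^ 2 * d.r / 250) * d.bumpConv (ξ - η) ≤ (-h ξ).re := by
      intro ξ hξ
      rw [hBp, Metric.mem_ball, dist_eq_norm] at hξ
      obtain ⟨hre0, hsig⟩ := d.signal_lower_bound hρ hT0 hT hNT hξ
      set R : ℝ := -(d.secondIterate T ξ 2).im / (2 * π) with hR
      have hR0 : 0 ≤ R := le_trans (by have := d.bumpConv_nonneg (ξ - η); positivity) hsig
      have hu_eq : d.secondIterate T ξ 2 = -(2 * π * R) * Complex.I := by
        rw [← Complex.re_add_im (d.secondIterate T ξ 2), hre0, hR]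
        push_cast
        field_simp
        ring
      have hφre : φ₀ ξ = ((φ₀ ξ).re : ℂ) := by
        rw [hφ₀, dyadicSymbol]; simp
      have hφhalf : 1 / 2 ≤ (φ₀ ξ).re := hφ ξ (lt_of_lt_of_le hξ hρρ₀)
      have hsin := sin_phase_ge hρ hρ0 hξ
      rw [← hx₀] at hsin
      have hval : (-h ξ).re = 2 * π * R * (φ₀ ξ).re * Real.sin (2 * π * ⟪ξ, x₀⟫) := by
        simp only [hh, Circle.smul_def, smul_eq_mul]
        rw [fourierChar_neg_inner, hu_eq, hφre]
        simp only [Complex.neg_re, Complex.mul_re, Complex.mul_im, Complex.sub_re, Complex.sub_im,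
          Complex.ofReal_re, Complex.ofReal_im, Complex.I_re, Complex.I_im, Complex.neg_re, Complex.neg_im,
          Complex.re_ofNat, Complex.im_ofNat]
        ring
      rw [hval]
      have h1 : d.α ^ 2 * d.r / 250 * d.bumpConv (ξ - η) ≤ R :=
        calc d.α ^ 2 * d.r / 250 * d.bumpConv (ξ - η) = d.α ^ 2 * d.r * d.bumpConv (ξ - η) / 250 := by ring
          _ ≤ R := hsig
      have h2 : 0 ≤ d.α ^ 2 * d.r / 250 * d.bumpConv (ξ - η) := by have := d.bumpConv_nonneg (ξ - η); positivity
      calc π * 0.999 * (d.α ^ 2 * d.r / 250) * d.bumpConv (ξ - η)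
          = 2 * π * (d.α ^ 2 * d.r / 250 * d.bumpConv (ξ - η)) * (1 / 2) * 0.999 := by ring
        _ ≤ 2 * π * R * (φ₀ ξ).re * Real.sin (2 * π * ⟪ξ, x₀⟫) := by
            apply mul_le_mul _ hsin (by norm_num) (by positivity)
            apply mul_le_mul _ hφhalf (by norm_num) (by positivity)
            exact mul_le_mul_of_nonneg_left h1 (by positivity)
    -- integrate over `Bp`
    have hBint : IntegrableOn (fun ξ => π * 0.999 * (d.α ^ 2 * d.r / 250) * d.bumpConv (ξ - η)) Bp :=
      ((d.integrable_bumpConv.comp_sub_right η).const_mul _).integrableOn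
    have hlow : ∫ ξ in Bp, π * 0.999 * (d.α ^ 2 * d.r / 250) * d.bumpConv (ξ - η) ≤ ∫ ξ in Bp, (-h ξ).re :=
      setIntegral_mono_on hBint (hhi.neg.re.integrableOn) hBpm hpt
    have hmass : ∫ ξ in Bp, π * 0.999 * (d.α ^ 2 * d.r / 250) * d.bumpConv (ξ - η) =
        π * 0.999 * (d.α ^ 2 * d.r / 250) * d.bumpMass ^ 2 := by
      rw [MeasureTheory.integral_const_mul]
      congr 1
      -- the shifted autocorrelation vanishes off `Bp`
      have hzero : ∀ ξ, ξ ∉ Bp → d.bumpConv (ξ - η) = 0 := fun ξ hξ => by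
        rw [hBp, Metric.mem_ball, dist_eq_norm, not_lt] at hξ
        exact d.bumpConv_eq_zero hξ
      rw [← MeasureTheory.integral_indicator hBpm]
      rw [show (Bp.indicator fun ξ => d.bumpConv (ξ - η)) = fun ξ => d.bumpConv (ξ - η) from funext fun ξ => by
        by_cases hx : ξ ∈ Bp
        · rw [Set.indicator_of_mem hx]
        · rw [Set.indicator_of_notMem hx, hzero ξ hx]]
      rw [integral_sub_right_eq_self d.bumpConv (η : E3), d.integral_bumpConv]
    have hre_int : ∫ ξ in Bp, (-h ξ).re = -(∫ ξ in Bp, h ξ).re := by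
      simp only [Complex.neg_re]
      rw [MeasureTheory.integral_neg]
      have := integral_re (hhi.integrableOn (s := Bp))
      simp only [RCLike.re_to_complex] at this
      rw [this]
    rw [hF, hre2]
    rw [hmass, hre_int] at hlow
    have hπ := Real.pi_gt_d2
    have hX : 0 ≤ d.α ^ 2 * d.r * d.bumpMass ^ 2 := by positivity
    have hπX : 3.14 * (d.α ^ 2 * d.r * d.bumpMass ^ 2) ≤ π * (d.α ^ 2 * d.r * d.bumpMass ^ 2) :=
      mul_le_mul_of_nonneg_right hπ.le hX
    nlinarith
  have := abs_le.1 hy_part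
  linarith [this.1]

/-! ### Helpers for the assembly -/

/-- **`φ₀ ≥ 1/2` near `e₀`**, by continuity (`φ₀(e₀) = 1`). [folklore] -/
theorem exists_rho0 : ∃ ρ₀ : ℝ, 0 < ρ₀ ∧ ∀ ξ : E3, ‖ξ - η‖ < ρ₀ → 1 / 2 ≤ (dyadicSymbol (E := E3) 0 ξ).re := by
  have hc : ContinuousAt (fun ξ : E3 => (dyadicSymbol (E := E3) 0 ξ).re) η :=
    (Complex.continuous_re.comp continuous_dyadicSymbol_zero).continuousAt
  have h1 : (dyadicSymbol (E := E3) 0 (η : E3)).re = 1 := by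
    rw [dyadicSymbol_zero_of_norm_eq_one norm_η]; simp
  obtain ⟨ρ₀, hρ₀, h⟩ := Metric.continuousAt_iff.1 hc (1 / 2) (by norm_num)
  refine ⟨ρ₀, hρ₀, fun ξ hξ => ?_⟩
  have := h (by rwa [dist_eq_norm])
  rw [h1, Real.dist_eq, abs_lt] at this
  linarith [this.1]

/-- The real constant behind `C_G`. [folklore] -/
def CGr : ℝ := 36 * π * (1 + (4 * π ^ 2)⁻¹)

/-- `C_G = ofReal C_Gʳ`. [folklore] -/
theorem CG_eq_ofReal : InflationParams.CG = ENNReal.ofReal CGr := by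
  have h1 : (0 : ℝ) ≤ (4 * π ^ 2)⁻¹ := by positivity
  have h2 : (0 : ℝ) ≤ 36 * π := by positivity
  rw [InflationParams.CG, InflationParams.nonlinMassConst_fin_three, CGr, ← ENNReal.ofReal_one,
    ← ENNReal.ofReal_add zero_le_one h1, ← ENNReal.ofReal_mul h2]

/-- `C_Gʳ > 0`. [folklore] -/
theorem CGr_pos : 0 < CGr := by unfold CGr; positivity

/-- `2 · ofReal x = ofReal (2x)`. [folklore] -/
theorem two_mul_ofReal {x : ℝ} : (2 : ℝ≥0∞) * ENNReal.ofReal x = ENNReal.ofReal (2 * x) := by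
  rw [ENNReal.ofReal_mul zero_le_two, ENNReal.ofReal_ofNat]

/-- **The linear coefficient in real terms.** [folklore] -/
theorem linCoef_eq_ofReal (d : InflationParams) {T : ℝ} :
    d.linCoef T = ENNReal.ofReal (CGr * (12 * d.α * d.bumpMass +
      96 * d.α ^ 2 * d.r * d.bumpMass ^ 2 * Real.sqrt T + 4000 * d.α ^ 2 * d.bumpMass ^ 2)) := by
  have hα := d.α_pos.le; have hm := d.bumpMass_nonneg
  have hA : 0 ≤ 2 * (6 * d.α * d.bumpMass) := by positivity
  have hB : 0 ≤ 2 * (48 * d.α ^ 2 * d.r * d.bumpMass ^ 2 * Real.sqrt T) := by positivity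
  have hC' : 0 ≤ 2 * (2000 * d.α ^ 2 * d.bumpMass ^ 2) := by positivity
  rw [InflationParams.linCoef, CG_eq_ofReal, two_mul_ofReal, two_mul_ofReal, two_mul_ofReal,
    ← ENNReal.ofReal_add hA hB, ← ENNReal.ofReal_add (add_nonneg hA hB) hC', ← ENNReal.ofReal_mul CGr_pos.le]
  congr 1; ring

/-- **The forcing in real terms** (for `T ≥ 0`). [folklore] -/
theorem forcing_eq_ofReal (d : InflationParams) {T : ℝ} (hT : 0 ≤ T) :
    d.forcing T = ENNReal.ofReal (CGr * (1320 * d.α ^ 3 * d.r * d.bumpMass ^ 3 +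
      2304 * d.α ^ 4 * d.r ^ 2 * d.bumpMass ^ 4 * T + 219000 * d.α ^ 4 * d.bumpMass ^ 4 * d.r)) := by
  have hα := d.α_pos.le; have hm := d.bumpMass_nonneg
  have hA : 0 ≤ 2 * (660 * d.α ^ 3 * d.r * d.bumpMass ^ 3) := by positivity
  have hB : 0 ≤ 2304 * d.α ^ 4 * d.r ^ 2 * d.bumpMass ^ 4 * T + 219000 * d.α ^ 4 * d.bumpMass ^ 4 * d.r := by
    positivity
  rw [InflationParams.forcing, CG_eq_ofReal, two_mul_ofReal, ← ENNReal.ofReal_add hA hB,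
    ← ENNReal.ofReal_mul CGr_pos.le]
  congr 1; ring

/-- **The norm of a vector is at most the sum of the moduli of its coordinates.** [folklore] -/
theorem euclidean_norm_le_sum_abs (v : E3) : ‖v‖ ≤ ∑ l, |v l| := by
  rw [EuclideanSpace.norm_eq]
  have h : ∑ l, ‖v l‖ ^ 2 ≤ (∑ l, |v l|) ^ 2 := by
    rw [sq, Finset.sum_mul_sum]
    refine Finset.sum_le_sum fun l _ => ?_
    rw [sq, Real.norm_eq_abs]
    exact Finset.single_le_sum (f := fun j => |v l| * |v j|) (fun j _ => mul_nonneg (abs_nonneg _) (abs_nonneg _))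
      (Finset.mem_univ l)
  calc Real.sqrt (∑ l, ‖v l‖ ^ 2) ≤ Real.sqrt ((∑ l, |v l|) ^ 2) := Real.sqrt_le_sqrt h
    _ = ∑ l, |v l| := Real.sqrt_sq (Finset.sum_nonneg fun l _ => abs_nonneg _)

/-- **The synthesized field of a coefficient field with an order-`4` weight is bounded**:
`‖synthVel W x‖ ≤ 3 A I₄`. [folklore] -/
theorem norm_synthVel_le_of_hasDecay {W : E3 → Fin 3 → ℂ} (hWc : Continuous W) {A : ℝ} (hW : HasDecay 4 A W)
    (x : E3) : ‖synthVel W x‖ ≤ 3 * (A * weightMass E3 4) := by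
  have hWi : Integrable W := hW.integrable InflationParams.finrank_lt_four hWc.aestronglyMeasurable
  have hWl : ∀ l, Integrable fun ξ => W ξ l := fun l =>
    hWi.norm.mono' ((continuous_apply l).comp hWc).aestronglyMeasurable
      (Eventually.of_forall fun ξ => norm_le_pi_norm (W ξ) l)
  have hmass : ∫ ξ, ‖W ξ‖ ≤ A * weightMass E3 4 := by
    rw [InflationParams.integral_norm_eq_toReal_massL1 hWc.aestronglyMeasurable]
    have := ENNReal.toReal_mono ENNReal.ofReal_ne_top (InflationParams.massL1_le_of_hasDecay hW)
    rwa [ENNReal.toReal_ofReal (mul_nonneg hW.nonneg (weightMass_nonneg 4))] at this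
  calc ‖synthVel W x‖ ≤ ∑ l, |synthVel W x l| := euclidean_norm_le_sum_abs _
    _ ≤ ∑ _l : Fin 3, (A * weightMass E3 4) := by
        refine Finset.sum_le_sum fun l _ => ?_
        rw [synthVel_apply]
        calc |(𝓕 (fun ξ => W ξ l) x).re| ≤ ‖𝓕 (fun ξ => W ξ l) x‖ := Complex.abs_re_le_norm _
          _ ≤ ∫ ξ, ‖W ξ l‖ := VectorFourier.norm_fourierIntegral_le_integral_norm _ _ _ _ _
          _ ≤ ∫ ξ, ‖W ξ‖ := integral_mono (hWl l).norm hWi.norm fun ξ => norm_le_pi_norm (W ξ) l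
          _ ≤ A * weightMass E3 4 := hmass
    _ = 3 * (A * weightMass E3 4) := by rw [Finset.sum_const, Finset.card_univ, Fintype.card_fin]; ring

/-- The synthesized field of a continuous coefficient field with an order-`4` weight is continuous. [folklore] -/
theorem continuous_synthVel_of_hasDecay {W : E3 → Fin 3 → ℂ} (hWc : Continuous W) {A : ℝ} (hW : HasDecay 4 A W) :
    Continuous (synthVel W) := by
  have hWi : Integrable W := hW.integrable InflationParams.finrank_lt_four hWc.aestronglyMeasurable
  have hWl : ∀ l, Integrable fun ξ => W ξ l := fun l =>
    hWi.norm.mono' ((continuous_apply l).comp hWc).aestronglyMeasurable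
      (Eventually.of_forall fun ξ => norm_le_pi_norm (W ξ) l)
  change Continuous fun x => ClayDatum.reVec fun l => 𝓕 (fun ξ => W ξ l) x
  exact ClayDatum.reVec.continuous.comp (continuous_pi fun l =>
    VectorFourier.fourierIntegral_continuous Real.continuous_fourierChar continuous_inner (hWl l))

/-- **The block `Δ̇₀` of the synthesized field is continuous** (it is `Re 𝓕(φ₀ W)`). [folklore] -/
theorem continuous_blockFn_zero_synthVel {W : E3 → Fin 3 → ℂ} (hWc : Continuous W) {A : ℝ} (hW : HasDecay 4 A W) :
    Continuous (blockFn 0 (synthVel W)) := by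
  have hWi : Integrable W := hW.integrable InflationParams.finrank_lt_four hWc.aestronglyMeasurable
  have hb := norm_synthVel_le_of_hasDecay hWc hW
  have heq : blockFn 0 (synthVel W) = fun x => ClayDatum.reVec fun l =>
      𝓕 (fun ξ => dyadicSymbol (E := E3) 0 ξ * W ξ l) x := by
    funext x; ext l
    rw [blockFn_zero_synthVel_apply hWc hWi hb x l, ClayDatum.reVec_apply]
  rw [heq]
  have hWl : ∀ l, Integrable fun ξ => dyadicSymbol (E := E3) 0 ξ * W ξ l := fun l => by
    refine hWi.norm.mono' ((continuous_dyadicSymbol_zero.mul ((continuous_apply l).comp hWc)).aestronglyMeasurable)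
      (Eventually.of_forall fun ξ => ?_)
    rw [norm_mul]
    calc ‖dyadicSymbol (E := E3) 0 ξ‖ * ‖W ξ l‖ ≤ 1 * ‖W ξ‖ :=
          mul_le_mul (norm_dyadicSymbol_zero_le_one ξ) (norm_le_pi_norm _ l) (norm_nonneg _) zero_le_one
      _ = ‖W ξ‖ := one_mul _
  exact ClayDatum.reVec.continuous.comp (continuous_pi fun l =>
    VectorFourier.fourierIntegral_continuous Real.continuous_fourierChar continuous_inner (hWl l))

/-! ### The choice of the scales -/

/-- **The real parameters.** Given the inflation size `δ`, the bump mass `m`, the constant `C = C_Gʳ`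
and the window constant `W`, there are `P = α² r`, a threshold `θ`, a time `T`, an amplitude `α`
and a number of scales `r` satisfying every smallness condition of the construction
(Bourgain–Pavlović's "appropriate `r`" and `T`, §3.3). [cite: BourgainPavlovic2008, §3.3] -/
theorem exists_scales {δ m C W : ℝ} (hδ : 0 < δ) (hm : 0 < m) (hC : 0 < C) (hW : 0 ≤ W) :
    ∃ (P θ T α : ℝ) (r : ℕ), 0 < P ∧ 0 < θ ∧ 0 < T ∧ 0 < α ∧ 0 < r ∧
      T ≤ 1 / 400 ∧ T < δ ∧ α ^ 2 * r = P ∧ 0.025 * P * m ^ 2 = 1 / δ + 1 ∧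
      16 * C * θ ≤ 1 ∧ θ ≤ 1 / 8 ∧ W * θ ≤ 1 / 2 ∧ 96 * α * m ≤ δ ∧
      C * (12 * α * m + 96 * α ^ 2 * r * m ^ 2 * Real.sqrt T + 4000 * α ^ 2 * m ^ 2) ≤ 1 / 4 ∧
      C * (1320 * α ^ 3 * r * m ^ 3 + 2304 * α ^ 4 * r ^ 2 * m ^ 4 * T + 219000 * α ^ 4 * m ^ 4 * r) ≤ θ := by
  -- the target size
  set P : ℝ := 40 * (1 / δ + 1) / m ^ 2 with hPdef
  have hPpos : 0 < P := by positivity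
  have hPm : 0.025 * P * m ^ 2 = 1 / δ + 1 := by rw [hPdef]; field_simp; ring
  -- the threshold
  set θ : ℝ := 1 / (16 * C + 8 + 2 * W + 1) with hθdef
  have hden : 0 < 16 * C + 8 + 2 * W + 1 := by positivity
  have hθpos : 0 < θ := by positivity
  have hθden : θ * (16 * C + 8 + 2 * W + 1) = 1 := by rw [hθdef]; field_simp
  have hθ16 : 16 * C * θ ≤ 1 := by nlinarith only [hθden, hθpos, hW]
  have hθ8 : θ ≤ 1 / 8 := by nlinarith only [hθden, hθpos, hW, hC]
  have hθW : W * θ ≤ 1 / 2 := by nlinarith only [hθden, hθpos, hW, hC]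
  -- the time
  set T₁ : ℝ := θ / (4608 * C * P ^ 2 * m ^ 4 + 1) with hT₁
  set T₂ : ℝ := (1 / (768 * C * P * m ^ 2 + 1)) ^ 2 with hT₂
  set T : ℝ := min (min (1 / 400) (δ / 2)) (min T₁ T₂) with hTdef
  have hTpos : 0 < T := lt_min (lt_min (by norm_num) (by linarith)) (lt_min (by positivity) (by positivity))
  have hT400 : T ≤ 1 / 400 := (min_le_left _ _).trans (min_le_left _ _)
  have hTδ : T < δ := lt_of_le_of_lt ((min_le_left _ _).trans (min_le_right _ _)) (by linarith)
  have hT1 : 2304 * C * P ^ 2 * m ^ 4 * T ≤ θ / 2 := by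
    have h1 : T ≤ T₁ := (min_le_right _ _).trans (min_le_left _ _)
    have h2 : 0 ≤ 4608 * C * P ^ 2 * m ^ 4 := by positivity
    have h3 : T₁ * (4608 * C * P ^ 2 * m ^ 4 + 1) = θ := by rw [hT₁]; field_simp
    nlinarith only [h1, h2, h3, hTpos, hθpos]
  have hT2 : 96 * C * P * m ^ 2 * Real.sqrt T ≤ 1 / 8 := by
    have h1 : T ≤ T₂ := (min_le_right _ _).trans (min_le_right _ _)
    have h0 : 0 < 768 * C * P * m ^ 2 + 1 := by positivity
    have h2 : Real.sqrt T ≤ 1 / (768 * C * P * m ^ 2 + 1) := by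
      rw [← Real.sqrt_sq (by positivity : (0 : ℝ) ≤ 1 / (768 * C * P * m ^ 2 + 1))]
      exact Real.sqrt_le_sqrt h1
    have h3 : 1 / (768 * C * P * m ^ 2 + 1) * (768 * C * P * m ^ 2 + 1) = 1 := by field_simp
    have h4 : 0 ≤ 768 * C * P * m ^ 2 := by positivity
    nlinarith only [h2, h3, h4, Real.sqrt_nonneg T, h0]
  -- the amplitude threshold and the number of scales
  set α₁ : ℝ := δ / (96 * m + 1) with hα₁
  set α₂ : ℝ := 1 / (8 * C * (12 * m + 4000 * m ^ 2) + 1) with hα₂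
  set α₃ : ℝ := θ / (2 * C * (1320 * P * m ^ 3 + 219000 * P * m ^ 4) + 1) with hα₃
  set αs : ℝ := min 1 (min α₁ (min α₂ α₃)) with hαsdef
  have hαspos : 0 < αs := lt_min one_pos (lt_min (by positivity) (lt_min (by positivity) (by positivity)))
  have hαs1 : αs ≤ 1 := min_le_left _ _
  set r : ℕ := ⌈P / αs ^ 2⌉₊ + 1 with hrdef
  have hr0 : (0 : ℝ) < r := by rw [hrdef]; positivity
  have hrge : P / αs ^ 2 ≤ r := by
    rw [hrdef]; push_cast; linarith only [Nat.le_ceil (P / αs ^ 2)]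
  set α : ℝ := Real.sqrt (P / r) with hαdef
  have hαpos : 0 < α := Real.sqrt_pos.2 (div_pos hPpos hr0)
  have hα2 : α ^ 2 = P / r := Real.sq_sqrt (div_pos hPpos hr0).le
  have hα2r : α ^ 2 * r = P := by rw [hα2]; field_simp
  have hαle : α ≤ αs := by
    rw [hαdef, ← Real.sqrt_sq hαspos.le]
    refine Real.sqrt_le_sqrt ?_
    rw [div_le_iff₀ hr0]
    have := (div_le_iff₀ (by positivity : (0:ℝ) < αs ^ 2)).1 hrge
    nlinarith only [this]
  have hα1 : α ≤ 1 := hαle.trans hαs1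
  have hαα : α ^ 2 ≤ α := by nlinarith only [hα1, hαpos]
  refine ⟨P, θ, T, α, r, hPpos, hθpos, hTpos, hαpos, Nat.succ_pos _, hT400, hTδ, hα2r, hPm, hθ16, hθ8, hθW,
    ?_, ?_, ?_⟩
  · -- `96 α m ≤ δ`
    have h1 : α ≤ α₁ := hαle.trans ((min_le_right _ _).trans (min_le_left _ _))
    have h2 : α₁ * (96 * m + 1) = δ := by rw [hα₁]; field_simp
    nlinarith only [h1, h2, hm, hαpos]
  · -- the linear coefficient
    have h1 : α ≤ α₂ := hαle.trans ((min_le_right _ _).trans ((min_le_right _ _).trans (min_le_left _ _)))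
    have h2 : α₂ * (8 * C * (12 * m + 4000 * m ^ 2) + 1) = 1 := by rw [hα₂]; field_simp
    have e : 96 * α ^ 2 * r * m ^ 2 * Real.sqrt T = 96 * P * m ^ 2 * Real.sqrt T := by rw [← hα2r]; ring
    have h3 : C * (12 * α * m + 4000 * α ^ 2 * m ^ 2) ≤ C * (12 * m + 4000 * m ^ 2) * α := by
      have : 4000 * α ^ 2 * m ^ 2 ≤ 4000 * α * m ^ 2 := by nlinarith only [hαα, sq_nonneg m]
      nlinarith only [this, hC, hm, hαpos]
    have h4 : C * (12 * m + 4000 * m ^ 2) * α ≤ 1 / 8 := by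
      have h5 : 0 ≤ C * (12 * m + 4000 * m ^ 2) := by positivity
      nlinarith only [h1, h2, h5, hαpos]
    have e' : C * (96 * α ^ 2 * r * m ^ 2 * Real.sqrt T) = 96 * C * P * m ^ 2 * Real.sqrt T := by rw [e]; ring
    have hsplit : C * (12 * α * m + 96 * α ^ 2 * r * m ^ 2 * Real.sqrt T + 4000 * α ^ 2 * m ^ 2) =
        C * (12 * α * m + 4000 * α ^ 2 * m ^ 2) + C * (96 * α ^ 2 * r * m ^ 2 * Real.sqrt T) := by ring
    rw [hsplit, e']
    linarith only [h3, h4, hT2]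
  · -- the forcing
    have h1 : α ≤ α₃ := hαle.trans ((min_le_right _ _).trans ((min_le_right _ _).trans (min_le_right _ _)))
    have h2 : α₃ * (2 * C * (1320 * P * m ^ 3 + 219000 * P * m ^ 4) + 1) = θ := by rw [hα₃]; field_simp
    have e1 : α ^ 3 * r = α * P := by rw [← hα2r]; ring
    have e2 : α ^ 4 * m ^ 4 * r = α ^ 2 * P * m ^ 4 := by rw [← hα2r]; ring
    have e3 : α ^ 4 * r ^ 2 = P ^ 2 := by rw [← hα2r]; ring
    have h3 : C * (1320 * α ^ 3 * r * m ^ 3 + 219000 * α ^ 4 * m ^ 4 * r) ≤ θ / 2 := by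
      rw [show 1320 * α ^ 3 * r * m ^ 3 = 1320 * (α ^ 3 * r) * m ^ 3 by ring, e1,
        show 219000 * α ^ 4 * m ^ 4 * r = 219000 * (α ^ 4 * m ^ 4 * r) by ring, e2]
      have h4 : α ^ 2 * P * m ^ 4 ≤ α * P * m ^ 4 :=
        mul_le_mul_of_nonneg_right (mul_le_mul_of_nonneg_right hαα hPpos.le) (by positivity)
      have h5 : 0 ≤ C * (1320 * P * m ^ 3 + 219000 * P * m ^ 4) := by positivity
      nlinarith only [h1, h2, h4, h5, hαpos, hC, hPpos, hm]
    rw [show 2304 * α ^ 4 * r ^ 2 * m ^ 4 * T = 2304 * (α ^ 4 * r ^ 2) * m ^ 4 * T by ring, e3]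
    nlinarith only [h3, hT1]

/-! ### The discharge -/

/-- **Bourgain–Pavlović's norm inflation theorem** (J. Funct. Anal. 255 (2008), Thm. 1.1), in the
form of the barrier fact `CriticalBesovNormInflation`: for every `δ > 0` there are a Schwartz,
divergence-free datum `u₀` on `ℝ³` with `‖u₀‖_{Ḃ^{-1}_{∞,∞}} ≤ δ`, a time `0 < t < δ`, and a
bounded classical solution `(u, p)` of Navier–Stokes (`ν = 1`) on `[0, t] × ℝ³` from `u₀` with
`‖u(t)‖_{Ḃ^{-1}_{∞,∞}} > 1/δ`. Proof: the Fourier-side construction of the series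
`BourgainPavlovic*` (`Literature/Analysis/FluidPDE/`), assembled as described in the module
docstring. [cite: BourgainPavlovic2008, Thm. 1.1 and §3] -/
theorem CriticalBesovNormInflation_holds : CriticalBesovNormInflation := by
  intro δ hδ
  haveI : Fact ((1 : ℝ≥0∞) ≤ ∞) := ⟨le_top⟩
  /- the radius `ρ` -/
  obtain ⟨ρ₀, hρ₀, hφ⟩ := exists_rho0
  set ρ : ℝ := min (ρ₀ / 2) (1 / 100) with hρdef
  have hρpos : 0 < ρ := lt_min (by linarith) (by norm_num)
  have hρ100 : ρ ≤ 1 / 100 := min_le_right _ _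
  have hρ10 : ρ ≤ 1 / 10 := hρ100.trans (by norm_num)
  have hρρ₀ : 2 * ρ ≤ ρ₀ := by have := min_le_left (ρ₀ / 2) (1 / 100); linarith
  /- the bump mass (depends on `ρ` only) -/
  set d₀ : InflationParams := ⟨ρ, hρpos, hρ10, 1, one_pos, 1, fun s => 3 + 3 * s, fun s => by omega,
    fun s => by omega⟩ with hd₀
  have hmpos : 0 < d₀.bumpMass := d₀.bump.integral_pos
  /- the scales -/
  obtain ⟨P, θ, T, α, r, hPpos, hθpos, hTpos, hαpos, hrpos, hT400, hTδ, hα2r, hPm, hθ16, hθ8, hθW, hαδ, hlinr, hforcr⟩ :=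
    exists_scales (m := d₀.bumpMass) (C := CGr) (W := decayWindowConst (Fin 3) 4) hδ hmpos CGr_pos
      (decayWindowConst_nonneg (ι := Fin 3) 4)
  /- the first dyadic exponent -/
  obtain ⟨k, hk⟩ := exists_nat_gt (1 / (8 * π ^ 2 * T))
  set n₀ : ℕ := k + 3 with hn₀
  have hNT : 1 ≤ 8 * π ^ 2 * ((2 : ℝ) ^ n₀) ^ 2 * T := by
    have h1 : (k : ℝ) < (2 : ℝ) ^ n₀ := by
      rw [hn₀]
      calc (k : ℝ) < (2 : ℝ) ^ k := by exact_mod_cast Nat.lt_two_pow_self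
        _ ≤ (2 : ℝ) ^ (k + 3) := pow_le_pow_right₀ one_le_two (by omega)
    have h2 : (2 : ℝ) ^ n₀ ≤ ((2 : ℝ) ^ n₀) ^ 2 := by
      have : (1 : ℝ) ≤ (2 : ℝ) ^ n₀ := one_le_pow₀ one_le_two
      nlinarith only [this]
    have h3 : 1 / (8 * π ^ 2 * T) < ((2 : ℝ) ^ n₀) ^ 2 := by linarith only [hk, h1, h2]
    have h4 : 0 < 8 * π ^ 2 * T := by positivity
    rw [div_lt_iff₀ h4] at h3
    linarith only [h3]
  /- the parameters -/
  set d : InflationParams := ⟨ρ, hρpos, hρ10, α, hαpos, r, fun s => n₀ + 3 * s, fun s => by omega,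
    fun s => by omega⟩ with hddef
  have hdm : d.bumpMass = d₀.bumpMass := rfl
  have hdα : d.α = α := rfl
  have hdr : (d.r : ℝ) = r := rfl
  have hdN : d.N 0 = (2 : ℝ) ^ n₀ := by
    show (2 : ℝ) ^ (n₀ + 3 * 0) = (2 : ℝ) ^ n₀
    rw [mul_zero, add_zero]
  have hNT' : 1 ≤ 8 * π ^ 2 * d.N 0 ^ 2 * T := by rw [hdN]; exact hNT
  /- the bootstrap hypotheses, in `ℝ≥0∞` -/
  set εr : ℝ := CGr * (1320 * α ^ 3 * r * d₀.bumpMass ^ 3 + 2304 * α ^ 4 * r ^ 2 * d₀.bumpMass ^ 4 * T +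
    219000 * α ^ 4 * d₀.bumpMass ^ 4 * r) with hεr
  have hεpos : 0 ≤ εr := by have := CGr_pos; positivity
  have hforc_eq : d.forcing T = ENNReal.ofReal εr := by
    rw [forcing_eq_ofReal d hTpos.le, hdα, hdr, hdm]
  have hε_toReal : (d.forcing T).toReal ≤ θ := by rw [hforc_eq, ENNReal.toReal_ofReal hεpos]; exact hforcr
  have hlin : 4 * d.linCoef T ≤ 1 := by
    rw [linCoef_eq_ofReal d, hdα, hdr, hdm, show (4 : ℝ≥0∞) = ENNReal.ofReal 4 by norm_num,
      ← ENNReal.ofReal_mul (by norm_num), ← ENNReal.ofReal_one]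
    exact ENNReal.ofReal_le_ofReal (by linarith only [hlinr])
  have hforc : 16 * InflationParams.CG * d.forcing T ≤ 1 := by
    rw [CG_eq_ofReal, hforc_eq, show (16 : ℝ≥0∞) = ENNReal.ofReal 16 by norm_num,
      ← ENNReal.ofReal_mul (by norm_num), ← ENNReal.ofReal_mul (by have := CGr_pos; positivity), ← ENNReal.ofReal_one]
    refine ENNReal.ofReal_le_ofReal ?_
    calc 16 * CGr * εr ≤ 16 * CGr * θ := mul_le_mul_of_nonneg_left hforcr (by have := CGr_pos; positivity)
      _ ≤ 1 := hθ16
  have hwin : 12 * decayWindowConst (Fin 3) 4 ^ 2 * (d.forcing T).toReal ^ 2 ≤ π ^ 2 := by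
    have hW0 : 0 ≤ decayWindowConst (Fin 3) 4 := decayWindowConst_nonneg (ι := Fin 3) 4
    have h1 : decayWindowConst (Fin 3) 4 * (d.forcing T).toReal ≤ 1 / 2 :=
      (mul_le_mul_of_nonneg_left hε_toReal hW0).trans hθW
    have h2 : 0 ≤ decayWindowConst (Fin 3) 4 * (d.forcing T).toReal := mul_nonneg hW0 ENNReal.toReal_nonneg
    have hπ := Real.pi_gt_three
    nlinarith only [h1, h2, hπ]
  /- the solution -/
  obtain ⟨A, u, p, V, hTao, hV, hsyn, hV0, hdecV⟩ := d.exists_taoSolution hTpos hlin hforc hwin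
  have hZ : pathNorm T (d.remainder V) ≤ 2 * d.forcing T := d.remainder_pathNorm_le hTpos le_rfl hV hV0 hlin hforc
  have hε_lt : d.forcing T < ⊤ := by rw [hforc_eq]; exact ENNReal.ofReal_lt_top
  /- the witnesses -/
  refine ⟨synthVel d.datum, d.datumDistrib, d.isSchwartzField_synthVel, d.isDivFree_synthVel,
    d.isDistributionOf_synthVel, ?_, T, hTpos, hTδ, u, p, ?_⟩
  · calc eHomBesovNorm (-1) ∞ ∞ d.datumDistrib ≤ ENNReal.ofReal (96 * d.α * d.bumpMass) := d.eHomBesovNorm_datumDistrib_le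
      _ ≤ ENNReal.ofReal δ := ENNReal.ofReal_le_ofReal hαδ
  -- the slice at time `T`
  have hVTc : Continuous (V T) := hV.continuous_slice T
  have hVTd : HasDecay 4 A (V T) := hdecV T ⟨hTpos.le, le_rfl⟩
  have huT : u T = synthVel (V T) := hsyn T ⟨hTpos.le, le_rfl⟩
  have hbdd : ∀ s ∈ Icc 0 T, ∀ x, ‖u s x‖ ≤ 3 * (A * weightMass E3 4) := fun s hs x => by
    rw [hsyn s hs]; exact norm_synthVel_le_of_hasDecay (hV.continuous_slice s) (hdecV s hs) x
  have huTc : Continuous (u T) := by rw [huT]; exact continuous_synthVel_of_hasDecay hVTc hVTd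
  have hmem : MemLp (u T) ∞ volume :=
    memLp_top_of_bound huTc.aestronglyMeasurable _ (Eventually.of_forall fun x => hbdd T ⟨hTpos.le, le_rfl⟩ x)
  obtain ⟨Ut, hUt⟩ := exists_isDistributionOf_of_memLp hmem
  refine ⟨Ut, hTao.classical, hTao.initial, ⟨3 * (A * weightMass E3 4), hbdd⟩, hUt, ?_⟩
  /- the lower bound -/
  set x₀ : E3 := (1 / 4 : ℝ) • (η : E3) with hx₀
  have hblock := block_lower_bound d hρ100 hTpos hT400 hNT' hρρ₀ hφ hV hZ hε_lt
  have hcomp : blockFn 0 (u T) x₀ 2 = (𝓕 (fun ξ : E3 => dyadicSymbol (E := E3) 0 ξ * V T ξ 2) x₀).re := by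
    rw [huT]
    exact blockFn_zero_synthVel_apply hVTc (hVTd.integrable InflationParams.finrank_lt_four hVTc.aestronglyMeasurable)
      (norm_synthVel_le_of_hasDecay hVTc hVTd) x₀ 2
  have hval : 1 / δ + 1 / 2 ≤ blockFn 0 (u T) x₀ 2 := by
    rw [hcomp]
    refine le_trans ?_ hblock
    have e : 0.025 * d.α ^ 2 * d.r * d.bumpMass ^ 2 = 1 / δ + 1 := by
      rw [hdα, hdr, hdm, ← hPm, ← hα2r]; ring
    rw [e]
    linarith only [hε_toReal, hθ8]
  have hδpos : (0 : ℝ) < 1 / δ := by positivity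
  have hcont : Continuous (blockFn 0 (u T)) := by rw [huT]; exact continuous_blockFn_zero_synthVel hVTc hVTd
  calc ENNReal.ofReal (1 / δ) < ENNReal.ofReal (blockFn 0 (u T) x₀ 2) := by
        rw [ENNReal.ofReal_lt_ofReal_iff (by linarith only [hval, hδpos])]
        linarith only [hval, hδpos]
    _ ≤ ‖blockFn 0 (u T) x₀‖ₑ := by
        rw [← ofReal_norm]
        exact ENNReal.ofReal_le_ofReal ((le_abs_self _).trans (abs_apply_le_norm (blockFn 0 (u T) x₀) 2))
    _ ≤ eLpNorm (blockFn 0 (u T)) ∞ volume := enorm_le_eLpNorm_top_of_continuous volume hcont x₀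
    _ = eLpNormDistrib ∞ (lpBlock 0 Ut) := (hUt.eLpNormDistrib_top_lpBlock_eq hmem 0).symm
    _ = (2 : ℝ≥0∞) ^ (((0 : ℤ) : ℝ) * (-1)) * eLpNormDistrib ∞ (lpBlock 0 Ut) := by simp
    _ ≤ eHomBesovNorm (-1) ∞ ∞ Ut := by
        rw [eHomBesovNorm_top]
        exact le_iSup (fun j : ℤ => (2 : ℝ≥0∞) ^ ((j : ℝ) * (-1)) * eLpNormDistrib ∞ (lpBlock j Ut)) 0

end Literature.Barriers.NavierStokesRegularity
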